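import Summits.CriticalPhenomena.PercolationContinuityZ3.Theorems.PercAnnulusCrossingTorusAnnulusCovering
import Summits.CriticalPhenomena.PercolationContinuityZ3.Theorems.PercAnnulusCrossingBoxCrossingWindow
import Summits.CriticalPhenomena.PercolationContinuityZ3.Theorems.PercAnnulusCrossingAnnulusLevelCertificate
import HarnessLib

/-!
# RSW3 lane (lead, gen 24): SYMMETRY AND SHARP THRESHOLDS, X — THE WINDOW PRINCIPLE FOR ANNULUS CROSSINGS and an EFFECTIVE
# SUPERCRITICAL STATEMENT IN EVERY DIMENSION: at `p_c + C/log L` thin annuli of scale `L` are crossed with probability `≥ 1 − δ`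

builds on p205010 (kernel theorem, internal audit signed; external expert review pending) — NOT used in this file
(every `d ≥ 2`, every `p ≥ p_c(ℤ^d)`; the only input at `p_c` is the tree's a-priori floor `85^{−d} ≤ P_{p_c}(Λ(L) ↔ ∂ⁱⁿΛ(2L))`,
Kesten Cor. 5.1, which holds at and above `p_c` in every dimension).

Cell `prim-rsw3` (LANE 3), lead seat, gen 24.  Support file (`--supports stmt-CriticalPhenomena-4575`); no definitions,
no named facts, no sorries.  Parts VIII–IX ran the Bollobás–Riordan symmetrisation for the tree's R1.a annulus event
`boxCrossing d n N = {Λ(n) ↔ ∂ⁱⁿΛ(N) in Λ(N)}`; with part II (Friedgut–Kalai on the torus):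

* **`real_boxCrossing_ge_one_sub_rpow_of_le`** — THE ANNULUS WINDOW THEOREM (every `d ≥ 1`, `a ≥ 1`, `Ka ≥ 3`, `n + a + 1 ≤ M`,
  `2(M+a) + 2 ≤ Ka`): `2(Ka)^{−d/4} ≤ ε ≤ P_p(boxCrossing d n (M+a))`, `0 < p ≤ q < 1`, `q ≥ p + 32·log(1/ε)/(d·log(Ka))` ⇒
  **`P_q(boxCrossing d (n+a) M) ≥ 1 − ε^{1/(K+1)^d}`** — from the level-`ε` threshold of the annulus `Λ(M+a) ∖ Λ(n)` to the
  high-probability regime of the thinner annulus `Λ(M) ∖ Λ(n+a)`;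
* **`real_boxCrossing_ge_one_sub_of_le`** — two-level form: window `≤ 32·(log(1/ε) + (K+1)^d·log(1/δ))/(d·log(Ka))` from level `ε`
  to level `1 − δ`;
* **`real_boxCrossing_ge_one_sub_of_criticalProbI_le`** — THE EFFECTIVE SUPERCRITICAL COROLLARY (every `d ≥ 2`): since
  `P_p(Λ(n) ↔ ∂ⁱⁿΛ(2n)) ≥ 85^{−d}` for EVERY `p ≥ p_c(ℤ^d)` and every `n ≥ 1` (the tree's `Rsw3.le_real_boxCrossing_two_mul_criticalProbI`
  + monotonicity), for `M + a = 2n`, `n + a + 1 ≤ M`, `2(M+a)+2 ≤ Ka` and `Ka` large (`2(Ka)^{−d/4} ≤ min(85^{−d}, δ^{(K+1)^d})`):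
  **`p ≥ p_c`, `q ≥ p + 32·(d·log 85 + (K+1)^d·log(1/δ))/(d·log(Ka))`, `q < 1` ⇒ `P_q(boxCrossing d (n+a) M) ≥ 1 − δ`.**
  READING: at `p = p_c + η` every annulus `Λ(M) ∖ Λ(n+a)` of aspect `< 2` at scale `n ≍ Ka ≥ exp(C_{d,K,δ}/η)` is crossed from
  inside with probability `≥ 1 − δ` — AN UPPER BOUND `exp(C/(p − p_c))` ON THE FINITE-SIZE CROSSING LENGTH ABOVE `p_c(ℤ^d)` IN
  EVERY DIMENSION `d ≥ 2`, with no input on `θ` (compare Duminil-Copin–Kozma–Tassion 2020's SUBcritical `ξ(p) ≤ exp(C/(p_c − p)²)`,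
  and the tree's two-sided `(log n)^{−1/2}` localisation of crossing thresholds, which this improves to `1/log n` on the
  supercritical side of thin annuli);
* **`eventually_real_boxCrossing_four_five_ge_one_sub`** — THE CROSSING-LENGTH FORM (every `d ≥ 2`, `0 < δ ≤ 1/2`): for all large `a`,
  every `p ≥ p_c(ℤ^d)` and `q ≥ p + C/log(14a)` (`C = 32(log 85^d + 15^d log(1/δ))/d`, `q < 1`):
  `P_q(Λ(4a) ↔ ∂ⁱⁿΛ(5a) in Λ(5a)) ≥ 1 − δ`.

References: B. Bollobás, O. Riordan, *Percolation* (CUP 2006), Ch. 2 Thm. 13, Ch. 3 Lemmas 7–8; E. Friedgut, G. Kalai, Proc. AMS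
124 (1996) Thm. 2.1; H. Kesten, *Percolation Theory for Mathematicians* (1982) Thm. 5.1, Cor. 5.1; H. Duminil-Copin, G. Kozma,
V. Tassion, *Upper bounds on the percolation correlation length* (2020), Thm. 2 (the subcritical counterpart).
-/

noncomputable section

namespace Summit.CriticalPhenomena.PercolationContinuityZ3.Theorems.Crossing

open MeasureTheory Literature.Probability.LatticeModels Literature.Probability.Percolation SimpleGraph
open Literature.Probability.Percolation.GhostField (torusTranslate)
open Summit.CriticalPhenomena.PercolationContinuityZ3.Theorems.SurfaceTension (boxCrossing measurableSet_boxCrossing)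
open Filter Topology

variable {d : ℕ}

/-! ## §1 The annulus window theorem -/

/-- **THE ANNULUS WINDOW THEOREM** (every `d ≥ 1`; `a ≥ 1`, `Ka ≥ 3`; `n + a + 1 ≤ M`, `2(M+a) + 2 ≤ Ka`): if
`2·(Ka)^{−d/4} ≤ ε ≤ P_p(boxCrossing d n (M+a))`, `0 < p ≤ q < 1` and `q ≥ p + 32·log(1/ε)/(d·log(Ka))`, then
**`P_q(boxCrossing d (n+a) M) ≥ 1 − ε^{1/(K+1)^d}`**. [cite: BollobasRiordan2006, Ch. 3, Lemma 8] [cite: FriedgutKalai1996, Thm. 2.1] -/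
theorem real_boxCrossing_ge_one_sub_rpow_of_le (hd : 1 ≤ d) {K a : ℕ} (ha : 1 ≤ a) (hL : 3 ≤ K * a) {n M : ℕ}
    (hnM : n + a + 1 ≤ M) (hfit : 2 * ((M : ℤ) + a) + 2 ≤ ((K * a : ℕ) : ℤ))
    {ε : ℝ} (hε : 2 * ((K * a : ℕ) : ℝ) ^ (-((d : ℝ) / 4)) ≤ ε) {p q : unitInterval} (hp0 : 0 < (p : ℝ))
    (hq1 : (q : ℝ) < 1) (hpq : p ≤ q) (hstart : ε ≤ (bondPercolation (zdGraph d) p).real (boxCrossing d n (M + a)))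
    (hwin : (p : ℝ) + 32 * Real.log (1 / ε) / (d * Real.log ((K * a : ℕ) : ℝ)) ≤ q) :
    1 - ε ^ (((K + 1) ^ d : ℕ) : ℝ)⁻¹ ≤ (bondPercolation (zdGraph d) q).real (boxCrossing d (n + a) M) := by
  haveI : NeZero (K * a) := ⟨by omega⟩
  have hL2 : 2 ≤ K * a := by omega
  have hfit' : 2 * ((M + a : ℕ) : ℤ) + 2 ≤ ((K * a : ℕ) : ℤ) := by push_cast at hfit ⊢; linarith
  have hfitM : 2 * (M : ℤ) + 2 ≤ ((K * a : ℕ) : ℤ) := by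
    have : (0 : ℤ) ≤ a := by positivity
    linarith
  set E : Set (BondConfig (TorusSite d (K * a))) :=
    ⋃ t : TorusSite d (K * a), (fun ω : BondConfig (TorusSite d (K * a)) =>
      restrictConfig (fun x : Site d => Torus.proj (K * a) x + t) ω ∩ (zdGraph d).edgeSet) ⁻¹' boxCrossing d n (M + a) with hE
  have h1 : ε ≤ (bondPercolation (torusGraph d (K * a)) p).real E :=
    hstart.trans (real_iUnion_lift_boxCrossing_ge (by omega) hfit' p)
  have h2 : 1 - ε ≤ (bondPercolation (torusGraph d (K * a)) q).real E :=
    torus_one_sub_le_real_rpow hL hd (isUpperSet_iUnion_lift (isUpperSet_boxCrossing n (M + a)))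
      (determinedBy_iUnion_lift hL2 (boxCrossing d n (M + a)))
      (fun u => relabel_preimage_iUnion_lift u (boxCrossing d n (M + a))) hε hp0 hq1 hpq h1 hwin
  have h3 := real_boxCrossing_ge_one_sub_rpow_of_iUnion_lift (d := d) hd ha hL2 hnM hfitM q
  have hrpow : (1 - (bondPercolation (torusGraph d (K * a)) q).real E) ^ (((K + 1) ^ d : ℕ) : ℝ)⁻¹ ≤
      ε ^ (((K + 1) ^ d : ℕ) : ℝ)⁻¹ :=
    Real.rpow_le_rpow (by linarith [(measureReal_le_one : (bondPercolation (torusGraph d (K * a)) q).real E ≤ 1)])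
      (by linarith) (by positivity)
  linarith

/-! ## §2 The two-level form -/

/-- **THE TWO-LEVEL ANNULUS WINDOW** (hypotheses on `d, K, a, n, M` as above): let `N = (K+1)^d`, `0 < δ` with
`2·(Ka)^{−d/4} ≤ δ^N ≤ 1/2`, and `2·(Ka)^{−d/4} ≤ ε ≤ 1/2`.  If `ε ≤ P_p(boxCrossing d n (M+a))`, `0 < p`, `q < 1` and
`q ≥ p + 32·(log(1/ε) + N·log(1/δ))/(d·log(Ka))`, then **`P_q(boxCrossing d (n+a) M) ≥ 1 − δ`**.
[cite: BollobasRiordan2006, Ch. 3, Lemma 8] [cite: FriedgutKalai1996, Thm. 2.1] -/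
theorem real_boxCrossing_ge_one_sub_of_le (hd : 1 ≤ d) {K a : ℕ} (ha : 1 ≤ a) (hL : 3 ≤ K * a) {n M : ℕ}
    (hnM : n + a + 1 ≤ M) (hfit : 2 * ((M : ℤ) + a) + 2 ≤ ((K * a : ℕ) : ℤ))
    {ε δ : ℝ} (hε : 2 * ((K * a : ℕ) : ℝ) ^ (-((d : ℝ) / 4)) ≤ ε) (hεhalf : ε ≤ 1 / 2) (hδ0 : 0 < δ)
    (hδ : 2 * ((K * a : ℕ) : ℝ) ^ (-((d : ℝ) / 4)) ≤ δ ^ ((K + 1) ^ d)) (hδhalf : δ ^ ((K + 1) ^ d) ≤ 1 / 2)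
    {p q : unitInterval} (hp0 : 0 < (p : ℝ)) (hq1 : (q : ℝ) < 1)
    (hstart : ε ≤ (bondPercolation (zdGraph d) p).real (boxCrossing d n (M + a)))
    (hwin : (p : ℝ) + 32 * (Real.log (1 / ε) + ((K + 1) ^ d : ℕ) * Real.log (1 / δ)) /
      (d * Real.log ((K * a : ℕ) : ℝ)) ≤ q) :
    1 - δ ≤ (bondPercolation (zdGraph d) q).real (boxCrossing d (n + a) M) := by
  haveI : NeZero (K * a) := ⟨by omega⟩
  have hL2 : 2 ≤ K * a := by omega
  have hfit' : 2 * ((M + a : ℕ) : ℤ) + 2 ≤ ((K * a : ℕ) : ℤ) := by push_cast at hfit ⊢; linarith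
  have hfitM : 2 * (M : ℤ) + 2 ≤ ((K * a : ℕ) : ℤ) := by
    have : (0 : ℤ) ≤ a := by positivity
    linarith
  have hLr : (1 : ℝ) < ((K * a : ℕ) : ℝ) := by exact_mod_cast (by omega : 1 < K * a)
  have hlogL : 0 < Real.log ((K * a : ℕ) : ℝ) := Real.log_pos hLr
  have hd0 : (0 : ℝ) < d := by exact_mod_cast hd
  have hden : 0 < (d : ℝ) * Real.log ((K * a : ℕ) : ℝ) := mul_pos hd0 hlogL
  have hε0 : 0 < ε := lt_of_lt_of_le (by positivity) hε
  have hlogε : 0 ≤ Real.log (1 / ε) := Real.log_nonneg (by rw [le_div_iff₀ hε0]; linarith)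
  have hlogδ : 0 ≤ Real.log (1 / δ) := by
    apply Real.log_nonneg
    rw [le_div_iff₀ hδ0, one_mul]
    by_contra h
    push Not at h
    have : (1 : ℝ) < δ ^ ((K + 1) ^ d) := one_lt_pow₀ h (by positivity)
    linarith
  set E : Set (BondConfig (TorusSite d (K * a))) :=
    ⋃ t : TorusSite d (K * a), (fun ω : BondConfig (TorusSite d (K * a)) =>
      restrictConfig (fun x : Site d => Torus.proj (K * a) x + t) ω ∩ (zdGraph d).edgeSet) ⁻¹' boxCrossing d n (M + a) with hE
  have hEup : IsUpperSet E := isUpperSet_iUnion_lift (isUpperSet_boxCrossing n (M + a))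
  have hEdet : DeterminedBy E (torusGraph d (K * a)).edgeSet := determinedBy_iUnion_lift hL2 (boxCrossing d n (M + a))
  have hEinv := fun u : TorusSite d (K * a) => relabel_preimage_iUnion_lift u (boxCrossing d n (M + a)) (L := K * a)
  -- the intermediate parameter
  have hr_le_q : (p : ℝ) + 32 * Real.log (1 / ε) / (d * Real.log ((K * a : ℕ) : ℝ)) ≤ q := by
    have : 32 * Real.log (1 / ε) / (d * Real.log ((K * a : ℕ) : ℝ)) ≤
        32 * (Real.log (1 / ε) + ((K + 1) ^ d : ℕ) * Real.log (1 / δ)) / (d * Real.log ((K * a : ℕ) : ℝ)) := by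
      apply div_le_div_of_nonneg_right _ hden.le
      nlinarith [hlogδ, (by positivity : (0 : ℝ) ≤ ((K + 1) ^ d : ℕ))]
    linarith
  have hp_le_r : (p : ℝ) ≤ (p : ℝ) + 32 * Real.log (1 / ε) / (d * Real.log ((K * a : ℕ) : ℝ)) := by
    have : 0 ≤ 32 * Real.log (1 / ε) / (d * Real.log ((K * a : ℕ) : ℝ)) := by positivity
    linarith
  set r : unitInterval := ⟨(p : ℝ) + 32 * Real.log (1 / ε) / (d * Real.log ((K * a : ℕ) : ℝ)),
    le_trans p.2.1 hp_le_r, le_trans hr_le_q q.2.2⟩ with hrdef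
  have hpr : p ≤ r := Subtype.coe_le_coe.1 hp_le_r
  have hrq : r ≤ q := Subtype.coe_le_coe.1 hr_le_q
  have hr1 : (r : ℝ) < 1 := lt_of_le_of_lt hr_le_q hq1
  have hr0 : 0 < (r : ℝ) := lt_of_lt_of_le hp0 hp_le_r
  -- step 1
  have h1 : ε ≤ (bondPercolation (torusGraph d (K * a)) p).real E :=
    hstart.trans (real_iUnion_lift_boxCrossing_ge (by omega) hfit' p)
  have h2 : 1 - ε ≤ (bondPercolation (torusGraph d (K * a)) r).real E :=
    torus_one_sub_le_real_rpow hL hd hEup hEdet hEinv hε hp0 hr1 hpr h1 le_rfl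
  have h3 : δ ^ ((K + 1) ^ d) ≤ (bondPercolation (torusGraph d (K * a)) r).real E :=
    le_of_one_sub_le_of_le_half h2 hεhalf hδhalf
  -- step 2
  have hwin' : (r : ℝ) + 32 * Real.log (1 / δ ^ ((K + 1) ^ d)) / (d * Real.log ((K * a : ℕ) : ℝ)) ≤ q := by
    rw [log_one_div_pow]
    have : (r : ℝ) = (p : ℝ) + 32 * Real.log (1 / ε) / (d * Real.log ((K * a : ℕ) : ℝ)) := rfl
    rw [this]
    have hsplit : 32 * (Real.log (1 / ε) + ((K + 1) ^ d : ℕ) * Real.log (1 / δ)) / (d * Real.log ((K * a : ℕ) : ℝ)) =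
        32 * Real.log (1 / ε) / (d * Real.log ((K * a : ℕ) : ℝ)) +
          32 * (((K + 1) ^ d : ℕ) * Real.log (1 / δ)) / (d * Real.log ((K * a : ℕ) : ℝ)) := by ring
    push_cast at hwin hsplit ⊢
    linarith
  have h4 : 1 - δ ^ ((K + 1) ^ d) ≤ (bondPercolation (torusGraph d (K * a)) q).real E :=
    torus_one_sub_le_real_rpow hL hd hEup hEdet hEinv hδ hr0 hq1 hrq h3 hwin'
  -- step 3
  have h5 := real_boxCrossing_ge_one_sub_rpow_of_iUnion_lift (d := d) hd ha hL2 hnM hfitM q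
  have hM0 : ((K + 1) ^ d : ℕ) ≠ 0 := by positivity
  have hrpow : (1 - (bondPercolation (torusGraph d (K * a)) q).real E) ^ (((K + 1) ^ d : ℕ) : ℝ)⁻¹ ≤
      (δ ^ ((K + 1) ^ d)) ^ (((K + 1) ^ d : ℕ) : ℝ)⁻¹ :=
    Real.rpow_le_rpow (by linarith [(measureReal_le_one : (bondPercolation (torusGraph d (K * a)) q).real E ≤ 1)])
      (by linarith) (by positivity)
  rw [pow_rpow_inv_natCast hδ0.le hM0] at hrpow
  linarith

/-! ## §3 The effective supercritical corollary -/

/-- **AT AND ABOVE `p_c(ℤ^d)` THE ASPECT-2 ANNULUS IS CROSSED WITH PROBABILITY `≥ 85^{−d}`** (every `d ≥ 2`, `n ≥ 1`): the tree's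
a-priori floor at `p_c` (`Rsw3.le_real_boxCrossing_two_mul_criticalProbI`, Kesten Cor. 5.1) and monotonicity in `p`.
[cite: Kesten1982, Thm. 5.1 and Cor. 5.1] -/
theorem le_real_boxCrossing_two_mul_of_criticalProbI_le (hd : 2 ≤ d) {n : ℕ} (hn : 1 ≤ n) {p : unitInterval}
    (hpc : criticalProbI d ≤ p) :
    ((85 : ℝ) ^ d)⁻¹ ≤ (bondPercolation (zdGraph d) p).real (boxCrossing d n (2 * n)) :=
  (Rsw3.le_real_boxCrossing_two_mul_criticalProbI hd hn).trans
    (DCT16.real_mono_of_isUpperSet (zdGraph d) (isUpperSet_boxCrossing n (2 * n)) (measurableSet_boxCrossing n (2 * n)) hpc)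

/-- **THE EFFECTIVE SUPERCRITICAL ANNULUS CROSSING** (every `d ≥ 2`; `a ≥ 1`, `Ka ≥ 3`; `n ≥ 1`, `M + a = 2n`, `n + a + 1 ≤ M`,
`2(M+a) + 2 ≤ Ka`; `N = (K+1)^d`; `0 < δ`, `2(Ka)^{−d/4} ≤ δ^N ≤ 1/2`, `2(Ka)^{−d/4} ≤ 85^{−d}`): for EVERY `p ≥ p_c(ℤ^d)` with
`0 < p`, and every `q < 1` with **`q ≥ p + 32·(log(85^d) + N·log(1/δ))/(d·log(Ka))`: `P_q(Λ(n+a) ↔ ∂ⁱⁿΛ(M) in Λ(M)) ≥ 1 − δ`**.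
In words: at `p_c + η` the annulus `Λ(M) ∖ Λ(n+a)` (aspect `M/(n+a) < 2`, as close to `2` as desired) at every scale with
`log(Ka) ≥ C_{d,K,δ}/η` is crossed from inside with probability at least `1 − δ` — the finite-size crossing length above `p_c`
is at most `exp(C/(p − p_c))`, in every dimension, from symmetry and the `85^{−d}` floor alone.
[cite: BollobasRiordan2006, Ch. 3, Lemma 8] [cite: FriedgutKalai1996, Thm. 2.1] [cite: Kesten1982, Cor. 5.1] -/
theorem real_boxCrossing_ge_one_sub_of_criticalProbI_le (hd : 2 ≤ d) {K a : ℕ} (ha : 1 ≤ a) (hL : 3 ≤ K * a) {n M : ℕ}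
    (hn : 1 ≤ n) (h2n : M + a = 2 * n) (hnM : n + a + 1 ≤ M) (hfit : 2 * ((M : ℤ) + a) + 2 ≤ ((K * a : ℕ) : ℤ))
    {δ : ℝ} (hδ0 : 0 < δ) (hδ : 2 * ((K * a : ℕ) : ℝ) ^ (-((d : ℝ) / 4)) ≤ δ ^ ((K + 1) ^ d))
    (hδhalf : δ ^ ((K + 1) ^ d) ≤ 1 / 2) (hε : 2 * ((K * a : ℕ) : ℝ) ^ (-((d : ℝ) / 4)) ≤ ((85 : ℝ) ^ d)⁻¹)
    {p q : unitInterval} (hp0 : 0 < (p : ℝ)) (hpc : criticalProbI d ≤ p) (hq1 : (q : ℝ) < 1)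
    (hwin : (p : ℝ) + 32 * (Real.log ((85 : ℝ) ^ d) + ((K + 1) ^ d : ℕ) * Real.log (1 / δ)) /
      (d * Real.log ((K * a : ℕ) : ℝ)) ≤ q) :
    1 - δ ≤ (bondPercolation (zdGraph d) q).real (boxCrossing d (n + a) M) := by
  have hd1 : 1 ≤ d := by omega
  have hstart : ((85 : ℝ) ^ d)⁻¹ ≤ (bondPercolation (zdGraph d) p).real (boxCrossing d n (M + a)) := by
    rw [h2n]; exact le_real_boxCrossing_two_mul_of_criticalProbI_le hd hn hpc
  have hεhalf : ((85 : ℝ) ^ d)⁻¹ ≤ 1 / 2 := by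
    rw [one_div]
    apply inv_anti₀ (by norm_num)
    have : (85 : ℝ) ^ 1 ≤ (85 : ℝ) ^ d := pow_le_pow_right₀ (by norm_num) hd1
    linarith
  have hlog : Real.log (1 / ((85 : ℝ) ^ d)⁻¹) = Real.log ((85 : ℝ) ^ d) := by rw [one_div, inv_inv]
  refine real_boxCrossing_ge_one_sub_of_le hd1 ha hL hnM hfit hε hεhalf hδ0 hδ hδhalf hp0 hq1 hstart ?_
  rw [hlog]; exact hwin

/-! ## §4 The crossing-length form -/

/-- The scale hypotheses of the effective corollary hold for all large `a`. [folklore] -/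
theorem eventually_two_mul_rpow_le (hd : 1 ≤ d) {c : ℝ} (hc : 0 < c) :
    ∀ᶠ a : ℕ in atTop, 2 * (((14 * a : ℕ) : ℝ)) ^ (-((d : ℝ) / 4)) ≤ c := by
  have h1 : Tendsto (fun a : ℕ => (((14 * a : ℕ) : ℝ))) atTop atTop := by
    have : Tendsto (fun a : ℕ => (14 * a : ℕ)) atTop atTop :=
      Filter.tendsto_id.const_mul_atTop' (by norm_num : 0 < 14)
    exact tendsto_natCast_atTop_atTop.comp this
  have h2 : Tendsto (fun x : ℝ => x ^ (-((d : ℝ) / 4))) atTop (𝓝 0) :=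
    tendsto_rpow_neg_atTop (by positivity)
  have h3 := (h2.comp h1).const_mul 2
  rw [mul_zero] at h3
  exact (h3.eventually (ge_mem_nhds hc)).mono fun a ha => ha

/-- **THE FINITE-SIZE CROSSING LENGTH ABOVE `p_c(ℤ^d)` IS AT MOST `exp(C/(p − p_c))`** (every `d ≥ 2`, every `0 < δ ≤ 1/2`;
the aspect-`5/4` annulus `Λ(5a) ∖ Λ(4a)`, torus side `14a`): there is an explicit `C = 32·(log 85^d + 15^d·log(1/δ))/d` such
that for all large `a`, **every `p ≥ p_c(ℤ^d)` and every `q < 1` with `q ≥ p + C/log(14a)` satisfy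
`P_q(Λ(4a) ↔ ∂ⁱⁿΛ(5a) in Λ(5a)) ≥ 1 − δ`** — at `p_c + η` the annulus crossing of scale `a ≥ exp(C/η)/14` already has
probability `≥ 1 − δ`, with no input on `θ` (`M + a = 2n` with `n = 3a`, `M = 5a`, `K = 14`).
[cite: BollobasRiordan2006, Ch. 3, Lemma 8] [cite: FriedgutKalai1996, Thm. 2.1] [cite: Kesten1982, Cor. 5.1] -/
theorem eventually_real_boxCrossing_four_five_ge_one_sub (hd : 2 ≤ d) {δ : ℝ} (hδ0 : 0 < δ) (hδ1 : δ ≤ 1 / 2) :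
    ∀ᶠ a : ℕ in atTop, ∀ p q : unitInterval, 0 < (p : ℝ) → criticalProbI d ≤ p → (q : ℝ) < 1 →
      (p : ℝ) + 32 * (Real.log ((85 : ℝ) ^ d) + ((14 + 1) ^ d : ℕ) * Real.log (1 / δ)) /
        (d * Real.log ((14 * a : ℕ) : ℝ)) ≤ q →
      1 - δ ≤ (bondPercolation (zdGraph d) q).real (boxCrossing d (4 * a) (5 * a)) := by
  have hd1 : 1 ≤ d := by omega
  have hδpow : 0 < δ ^ ((14 + 1) ^ d) := by positivity
  have hδhalf : δ ^ ((14 + 1) ^ d) ≤ 1 / 2 := by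
    calc δ ^ ((14 + 1) ^ d) ≤ δ ^ 1 := pow_le_pow_of_le_one hδ0.le (by linarith) (Nat.one_le_pow _ _ (by norm_num))
      _ ≤ 1 / 2 := by rw [pow_one]; exact hδ1
  have h85 : 0 < ((85 : ℝ) ^ d)⁻¹ := by positivity
  filter_upwards [eventually_two_mul_rpow_le hd1 hδpow, eventually_two_mul_rpow_le hd1 h85,
    eventually_ge_atTop 1] with a hδ hε ha p q hp0 hpc hq1 hwin
  have h := real_boxCrossing_ge_one_sub_of_criticalProbI_le hd (K := 14) (a := a) ha (by omega) (n := 3 * a) (M := 5 * a)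
    (by omega) (by omega) (by omega) (by push_cast; linarith) hδ0 hδ hδhalf hε hp0 hpc hq1 hwin
  simpa only [show 3 * a + a = 4 * a by ring] using h

end Summit.CriticalPhenomena.PercolationContinuityZ3.Theorems.Crossing

end
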